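import Literature.Probability.FitznerVanDerHofstad2017.BlockSummation
import Literature.Probability.FitznerVanDerHofstad2017.NobleBoundsN1Classes
import HarnessLib

/-!
# [FvdH17] §6.1 (6.4) / §6.2.1 (6.48)–(6.51) for general `N`: the length classes of an `N`-level diagram and the regrouping of a pointwise bound into the block recursion `P^{(N)}` — PROVED

Source: R. Fitzner, R. van der Hofstad, *Mean-field behavior for nearest-neighbor percolation in `d > 10`*,
Electron. J. Probab. **22** (2017) no. 43 [FvdH17]; page / equation numbers are those of the extended version
arXiv:1506.07977v2: §6.1 (6.4) and "Case `a = 0` / `a = 1` / `a = 2`" (pp. 58–59), §6.2.1 (6.48)–(6.50) (p. 65),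
Lemma 6.1 (6.51) (p. 66) and the closing paragraph of §6.2.1 (p. 67):

  p. 67: "To prove the bounds for all `N` we use induction on `N`. … Once the `x`-wise bounds of Lemma 6.1 are
  proven, we use a split as demonstrated in (6.5) to conclude the bounds stated in Propositions 5.5 and 5.6."
  (6.49) (p. 65): "`P^{(N),b}(u_N,w_N) = Σ_{u_{N-1},w_{N-1} ∈ ℤ^d} Σ_κ Σ_{a=0}^{2} P^{(N-1),b}(u_{N-1},w_{N-1})
  B^{κ,a,b}(u_{N-1},w_{N-1},w_N,u_N)`".
  §6.1 (p. 58): "`Ξ^{(1)}(x) ≤ Σ_{u,w,t,z} Σ_ι Σ_{a,b} P^{S,a}(u,w) Ā^{ι,a,b}(u,w,t,z) P^{E,b}(t−x,z−x)`, (6.4) where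
  `Σ_ι` is the sum over the direction of the bond `b₁ = (x₁, x₁ + e_ι)` … Case `a = 0`: … `w = u` … Case `a = 1`:
  … `u` and `w` are neighbors …".

What this module proves (kernel-checked, nothing cited as a hypothesis; companion of `BlockSummation`, whose
`recP` is the recursion (6.48)–(6.49), and of `NobleBoundsN1Classes`, the `N = 1` case).

§1 (namespace `BlockSummation`, abstract, all sums in `ℝ≥0∞`).  The `x`-space bound of Lemma 6.1 for general
`N` is obtained in [FvdH17] by bounding the `N`-level diagram POINTWISE — for fixed pivotal bonds
`b_i = (u_i, v_i)`, attachment points `w_i` and sausage end-points `t_i, z_i` of every level, and fixed length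
classes `a_i` of the lines `(u_i, w_i)` and `c` of the last `(t, z)` — by the chain
`P^{S,a_0}(u_0,w_0) · ∏_i B_pt^{κ_i,a_i,a_{i+1}}(u_i,w_i,t_i,z_i,w_{i+1},u_{i+1}) · Ā^{κ,a,c}(u,w,t,z) · P^{E,c}(t−x,z−x)`
restricted to `v_i = u_i + e_{κ_i}` (`dirInd`, `chainTail`), and then SUMMING: the internal vertices `t_i, z_i`
of each middle block first (`Σ_{t,z} B_pt ≤ B`, hypothesis `hBpt`), and the level sums regrouped, first level
first, into the recursion `P^{(N)}` of (6.49).  `le_recP_chain_of_pointwise` is exactly this bookkeeping, by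
induction on the number `n` of middle blocks (`level0_le_recP_one` sums the first level;
`recP_succ_eq_recP_recP_one : recP PS B (N+1) = recP (recP PS B 1) B N`); its conclusion is literally the
hypothesis `hΞ` (at one `x`) of `BlockSummation.tsum_le_vecMul_pow_dotProduct'` and of the (6.4)-order chain
corollaries, so that pointwise diagrammatic estimates + this lemma + the chain theorem give (5.34)/(5.37).
Tools: first-coordinate splits of sums over `Fin (n+1) → β` (`tsum_pi_succ`, `sum_pi_succ`, `tsum_pi_succ₄`).

§2 (namespace `FitznerVanDerHofstad2017`, percolation side, interface only).  `lineClass a b η ∈ {0,1,2}`, the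
length class of the line `{a ↔ b}` on one configuration; `clsSetN u w t z a c`, the class tuple of an
`(n+2)`-level configuration (class `a i` of `(u_i, w_i)` read on level `i`, class `c` of `(t, z)` read on the last
level; at `n = 0` this is the event `NobleBoundsN1Classes.clsSet`); measurability, cover,
`μ(E) ≤ Σ_{a,c} μ(E ∩ class (a,c))`; and the assembly **`nobleXiT_le_recP_chain_of_cls`**: from a joint form
`Ξ^{(n+1)}_p(x) ≤ Σ_{b,w,t,z} (∏_i J(v_i−u_i)) ℙ_p^{⊗(n+2)}(E(b,w,t,z))` and ONE pointwise estimate per class tuple,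
the `x`-space bound `Ξ^{(n+1)}_p(x) ≤ Σ_{u,w,t,z} Σ_{κ,a,c} P^{(n),a}(u,w) Ā^{κ,a,c}(u,w,t,z) P^{E,c}(t−x,z−x)`.
The event family `E` and the block families `S, B, B_pt, Ā, P^E` are parameters.

NOT in this module: the pointwise diagrammatic estimates themselves ([FvdH17] §4 / App. B), the building blocks
of §5.1, the joint form for `N ≥ 2` (a union bound on `NobleNestedXi.nobleXiT_succ_succ_eq_tsum`), and any
numerical instantiation.
-/

noncomputable section

namespace Literature.Probability.FitznerVanDerHofstad2017.BlockSummation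

open scoped ENNReal BigOperators

/-! ## Splitting sums over `Fin (n+1) → β` at the first coordinate -/

section Split

variable {α β γ δ : Type*} {n : ℕ}

/-- `Σ_{f : Fin (n+1) → β} F(f) = Σ_{a} Σ_{g : Fin n → β} F(a ∷ g)` in `ℝ≥0∞`. [folklore] -/
theorem tsum_pi_succ (F : (Fin (n + 1) → β) → ℝ≥0∞) :
    ∑' f, F f = ∑' a : β, ∑' g : Fin n → β, F (Fin.cons a g) := by
  rw [← (Fin.consEquiv fun _ : Fin (n + 1) => β).tsum_eq, ENNReal.tsum_prod']
  rfl

/-- `Σ_{f : Fin (n+1) → β} F(f) = Σ_{a} Σ_{g : Fin n → β} F(a ∷ g)` for a finite sum. [folklore] -/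
theorem sum_pi_succ [Fintype β] (F : (Fin (n + 1) → β) → ℝ≥0∞) :
    ∑ f, F f = ∑ a : β, ∑ g : Fin n → β, F (Fin.cons a g) := by
  rw [← (Fin.consEquiv fun _ : Fin (n + 1) => β).sum_comp, Fintype.sum_prod_type]
  rfl

/-- `Σ_{f : Fin (n+1) → β} F(f) = Σ_{g : Fin n → β} Σ_{a} F(a ∷ g)` for a finite sum (tail outermost). [folklore] -/
theorem sum_pi_succ' [Fintype β] (F : (Fin (n + 1) → β) → ℝ≥0∞) :
    ∑ f, F f = ∑ g : Fin n → β, ∑ a : β, F (Fin.cons a g) := by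
  rw [sum_pi_succ, Finset.sum_comm]

/-- `Σ_{f : Fin 0 → β} F(f) = F(∅)` in `ℝ≥0∞`. [folklore] -/
theorem tsum_pi_zero (F : (Fin 0 → β) → ℝ≥0∞) : ∑' f, F f = F Fin.elim0 := by
  rw [tsum_fintype, Fintype.sum_unique]
  exact congrArg F (Subsingleton.elim _ _)

/-- `Σ_{f : Fin 0 → β} F(f) = F(∅)` for a finite sum. [folklore] -/
theorem sum_pi_zero [Fintype β] (F : (Fin 0 → β) → ℝ≥0∞) : ∑ f, F f = F Fin.elim0 := by
  rw [Fintype.sum_unique]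
  exact congrArg F (Subsingleton.elim _ _)

/-- The four-fold first-coordinate split `((α × β × γ × δ) × tails) ≃ (functions on Fin (n+1))⁴`. [folklore] -/
def consEquiv₄ (α β γ δ : Type*) (n : ℕ) :
    ((α × β × γ × δ) × ((Fin n → α) × (Fin n → β) × (Fin n → γ) × (Fin n → δ))) ≃
      ((Fin (n + 1) → α) × (Fin (n + 1) → β) × (Fin (n + 1) → γ) × (Fin (n + 1) → δ)) where
  toFun p := (Fin.cons p.1.1 p.2.1, Fin.cons p.1.2.1 p.2.2.1, Fin.cons p.1.2.2.1 p.2.2.2.1,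
    Fin.cons p.1.2.2.2 p.2.2.2.2)
  invFun q := ((q.1 0, q.2.1 0, q.2.2.1 0, q.2.2.2 0),
    (Fin.tail q.1, Fin.tail q.2.1, Fin.tail q.2.2.1, Fin.tail q.2.2.2))
  left_inv p := by simp [Fin.tail_cons, Fin.cons_zero]
  right_inv q := by simp [Fin.cons_self_tail]

/-- Four simultaneous first-coordinate splits, tails outermost:
`Σ_{b,w,t,z : Fin (n+1) → ·} P = Σ_{b',w',t',z' : Fin n → ·} Σ_{b₀,w₀,t₀,z₀} P(b₀ ∷ b', w₀ ∷ w', t₀ ∷ t', z₀ ∷ z')`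
in `ℝ≥0∞`. [folklore] -/
theorem tsum_pi_succ₄ (P : (Fin (n + 1) → α) → (Fin (n + 1) → β) → (Fin (n + 1) → γ) → (Fin (n + 1) → δ) → ℝ≥0∞) :
    ∑' b, ∑' w, ∑' t, ∑' z, P b w t z =
      ∑' b', ∑' w', ∑' t', ∑' z', ∑' b₀, ∑' w₀, ∑' t₀, ∑' z₀,
        P (Fin.cons b₀ b') (Fin.cons w₀ w') (Fin.cons t₀ t') (Fin.cons z₀ z') := by
  set F : (Fin (n + 1) → α) × (Fin (n + 1) → β) × (Fin (n + 1) → γ) × (Fin (n + 1) → δ) → ℝ≥0∞ :=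
    fun q => P q.1 q.2.1 q.2.2.1 q.2.2.2 with hF
  have hL : ∑' q, F q = ∑' b, ∑' w, ∑' t, ∑' z, P b w t z := by
    simp only [hF, ENNReal.tsum_prod']
  rw [← hL, ← (consEquiv₄ α β γ δ n).tsum_eq F, ENNReal.tsum_prod', ENNReal.tsum_comm]
  simp only [ENNReal.tsum_prod']
  rfl

/-- `Σ_{b,w,t,z : Fin 1 → ·} P = Σ_{b₀,w₀,t₀,z₀} P(b₀ ∷ ∅, …)` in `ℝ≥0∞`. [folklore] -/
theorem tsum_pi_one₄ (P : (Fin 1 → α) → (Fin 1 → β) → (Fin 1 → γ) → (Fin 1 → δ) → ℝ≥0∞) :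
    ∑' b, ∑' w, ∑' t, ∑' z, P b w t z =
      ∑' b₀, ∑' w₀, ∑' t₀, ∑' z₀, P (Fin.cons b₀ Fin.elim0) (Fin.cons w₀ Fin.elim0)
        (Fin.cons t₀ Fin.elim0) (Fin.cons z₀ Fin.elim0) := by
  rw [tsum_pi_succ₄, tsum_pi_zero, tsum_pi_zero, tsum_pi_zero, tsum_pi_zero]

end Split

/-! ## The pointwise chain and its regrouping into `P^{(N)}` -/

section Chain

variable {G ι K : Type*} [AddCommGroup G] [DecidableEq G] [Fintype ι] [Fintype K]

/-- The direction constraint of the pivotal bonds, `∏_i 𝟙{v_i = u_i + e_{κ_i}}` (`b_i = (u_i, v_i)`).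
[cite: FitznerVanDerHofstad2017, §6.1 (6.4) "where `Σ_ι` is the sum over the direction of the bond `b₁ = (x₁, x₁ + e_ι)`" (arXiv:1506.07977v2 p. 58)] -/
def dirInd (e : K → G) {n : ℕ} (κ : Fin n → K) (b : Fin n → G × G) : ℝ≥0∞ :=
  ∏ i, if (b i).2 = (b i).1 + e (κ i) then 1 else 0

/-- The `P^S`-free part of the pointwise bounding chain with `n` middle blocks: the pointwise middle blocks
`B_pt^{κ_i,a_i,a_{i+1}}(u_i,w_i,t_i,z_i,w_{i+1},u_{i+1})` (`i < n`, internal vertices `t_i, z_i` NOT yet summed),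
the last open block `Ā^{κ_n,a_n,c}(u_n,w_n,t_n,z_n)` and the end `P^{E,c}(t_n − x, z_n − x)`.
[cite: FitznerVanDerHofstad2017, §6.2.1 (6.48)–(6.51) (arXiv:1506.07977v2 pp. 65–66)] -/
def chainTail (Bpt : K → ι → ι → G → G → G → G → G → G → ℝ≥0∞) (A : K → ι → ι → G → G → G → G → ℝ≥0∞)
    (PE : ι → G → G → ℝ≥0∞) (x : G) (n : ℕ) (κ : Fin (n + 1) → K) (a : Fin (n + 1) → ι) (c : ι)
    (b : Fin (n + 1) → G × G) (w t z : Fin (n + 1) → G) : ℝ≥0∞ :=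
  (∏ i : Fin n, Bpt (κ i.castSucc) (a i.castSucc) (a i.succ) (b i.castSucc).1 (w i.castSucc) (t i.castSucc)
      (z i.castSucc) (w i.succ) (b i.succ).1) *
    (A (κ (Fin.last n)) (a (Fin.last n)) c (b (Fin.last n)).1 (w (Fin.last n)) (t (Fin.last n)) (z (Fin.last n)) *
      PE c (t (Fin.last n) - x) (z (Fin.last n) - x))

omit [Fintype ι] [Fintype K] in
/-- Peeling the first bond off the direction constraint. [folklore] -/
theorem dirInd_cons (e : K → G) {n : ℕ} (κ₀ : K) (κ : Fin n → K) (b₀ : G × G) (b : Fin n → G × G) :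
    dirInd e (Fin.cons κ₀ κ : Fin (n + 1) → K) (Fin.cons b₀ b) =
      (if b₀.2 = b₀.1 + e κ₀ then 1 else 0) * dirInd e κ b := by
  unfold dirInd
  rw [Fin.prod_univ_succ]
  simp only [Fin.cons_zero, Fin.cons_succ]

omit [DecidableEq G] [Fintype ι] [Fintype K] in
/-- No middle block: the chain is `Ā · P^E`. [folklore] -/
theorem chainTail_zero (Bpt : K → ι → ι → G → G → G → G → G → G → ℝ≥0∞)
    (A : K → ι → ι → G → G → G → G → ℝ≥0∞) (PE : ι → G → G → ℝ≥0∞) (x : G)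
    (κ : Fin 1 → K) (a : Fin 1 → ι) (c : ι) (b : Fin 1 → G × G) (w t z : Fin 1 → G) :
    chainTail Bpt A PE x 0 κ a c b w t z =
      A (κ 0) (a 0) c (b 0).1 (w 0) (t 0) (z 0) * PE c (t 0 - x) (z 0 - x) := by
  unfold chainTail
  rw [Fin.prod_univ_zero, one_mul]
  rfl

omit [DecidableEq G] [Fintype ι] [Fintype K] in
/-- Peeling the first middle block off the chain. [folklore] -/
theorem chainTail_succ_cons (Bpt : K → ι → ι → G → G → G → G → G → G → ℝ≥0∞)
    (A : K → ι → ι → G → G → G → G → ℝ≥0∞) (PE : ι → G → G → ℝ≥0∞) (x : G) (n : ℕ)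
    (κ₀ : K) (κ : Fin (n + 1) → K) (a₀ : ι) (a : Fin (n + 1) → ι) (c : ι)
    (b₀ : G × G) (b : Fin (n + 1) → G × G) (w₀ t₀ z₀ : G) (w t z : Fin (n + 1) → G) :
    chainTail Bpt A PE x (n + 1) (Fin.cons κ₀ κ) (Fin.cons a₀ a) c (Fin.cons b₀ b) (Fin.cons w₀ w)
        (Fin.cons t₀ t) (Fin.cons z₀ z) =
      Bpt κ₀ a₀ (a 0) b₀.1 w₀ t₀ z₀ (w 0) (b 0).1 * chainTail Bpt A PE x n κ a c b w t z := by
  unfold chainTail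
  rw [Fin.prod_univ_succ, mul_assoc]
  simp only [Fin.cons_zero, Fin.cons_succ, Fin.castSucc_zero, Fin.succ_zero_eq_one, ← Fin.succ_castSucc,
    ← Fin.succ_last]
  rfl

omit [Fintype ι] [Fintype K] in
/-- Summing out the end-point of a pivotal bond against its direction constraint. [folklore] -/
theorem tsum_ite_dir_mul (e : K → G) (u : G) (κ : K) (X : ℝ≥0∞) :
    ∑' v : G, (if v = u + e κ then (1 : ℝ≥0∞) else 0) * X = X := by
  rw [ENNReal.tsum_mul_right, tsum_ite_eq, one_mul]

omit [AddCommGroup G] [DecidableEq G] in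
/-- `P^{(N+1)} = (P^{(1)})^{(N)}`: the recursion (6.49) run from the composite start `P^{(1)}`. [folklore] -/
theorem recP_succ_eq_recP_recP_one (PS : ι → G → G → ℝ≥0∞) (B : K → ι → ι → G → G → G → G → ℝ≥0∞) :
    ∀ N : ℕ, recP PS B (N + 1) = recP (recP PS B 1) B N
  | 0 => rfl
  | N + 1 => by
    funext b u w
    rw [recP_succ, recP_succ, recP_succ_eq_recP_recP_one PS B N]

omit [AddCommGroup G] [DecidableEq G] in
/-- `Σ_a Σ_b Σ_c F = Σ_c Σ_a Σ_b F` for finite sums. [folklore] -/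
theorem sum_rot₃' {α β γ : Type*} [Fintype α] [Fintype β] [Fintype γ] (F : α → β → γ → ℝ≥0∞) :
    ∑ a, ∑ b, ∑ c, F a b c = ∑ c, ∑ a, ∑ b, F a b c :=
  (Finset.sum_congr rfl fun _ _ => Finset.sum_comm).trans Finset.sum_comm

omit [Fintype ι] [Fintype K] in
/-- No bond: the direction constraint is empty. [folklore] -/
theorem dirInd_nil (e : K → G) (κ : Fin 0 → K) (b : Fin 0 → G × G) : dirInd e κ b = 1 := by
  unfold dirInd
  exact Fin.prod_univ_zero _

/-- Summing the FIRST level: bond `(u₀, v₀)` against its direction constraint, the internal vertices `t₀, z₀` of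
the first middle block (`Σ_{t,z} B_pt ≤ B`), then `u₀, w₀, κ₀, a₀` — this is one step of (6.49):
`Σ P^{S,a₀}(u₀,w₀) B^{κ₀,a₀,a₁}(u₀,w₀,w₁,u₁) = P^{(1),a₁}(u₁,w₁)`.
[cite: FitznerVanDerHofstad2017, §6.2.1 (6.49) (arXiv:1506.07977v2 p. 65)] -/
theorem level0_le_recP_one (e : K → G) (S : ι → G → G → ℝ≥0∞) (B : K → ι → ι → G → G → G → G → ℝ≥0∞)
    (Bpt : K → ι → ι → G → G → G → G → G → G → ℝ≥0∞)
    (hBpt : ∀ κ a a' u w w' u', ∑' t, ∑' z, Bpt κ a a' u w t z w' u' ≤ B κ a a' u w w' u')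
    (a₁ : ι) (u₁ w₁ : G) :
    ∑ κ₀, ∑ a₀, ∑' b₀ : G × G, ∑' w₀, ∑' t₀, ∑' z₀, (if b₀.2 = b₀.1 + e κ₀ then (1 : ℝ≥0∞) else 0) *
        (S a₀ b₀.1 w₀ * Bpt κ₀ a₀ a₁ b₀.1 w₀ t₀ z₀ w₁ u₁) ≤ recP S B 1 a₁ u₁ w₁ := by
  have key : ∀ κ₀ a₀, ∑' b₀ : G × G, ∑' w₀, ∑' t₀, ∑' z₀, (if b₀.2 = b₀.1 + e κ₀ then (1 : ℝ≥0∞) else 0) *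
        (S a₀ b₀.1 w₀ * Bpt κ₀ a₀ a₁ b₀.1 w₀ t₀ z₀ w₁ u₁) =
      ∑' u₀, ∑' w₀, S a₀ u₀ w₀ * ∑' t₀, ∑' z₀, Bpt κ₀ a₀ a₁ u₀ w₀ t₀ z₀ w₁ u₁ := by
    intro κ₀ a₀
    rw [ENNReal.tsum_prod']
    refine tsum_congr fun u₀ => ?_
    dsimp only
    rw [tsum_rot₄]
    simp only [tsum_ite_dir_mul, ENNReal.tsum_mul_left]
  calc _ = ∑ κ₀, ∑ a₀, ∑' u₀, ∑' w₀, S a₀ u₀ w₀ * ∑' t₀, ∑' z₀, Bpt κ₀ a₀ a₁ u₀ w₀ t₀ z₀ w₁ u₁ :=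
        Finset.sum_congr rfl fun κ₀ _ => Finset.sum_congr rfl fun a₀ _ => key κ₀ a₀
    _ ≤ ∑ κ₀, ∑ a₀, ∑' u₀, ∑' w₀, S a₀ u₀ w₀ * B κ₀ a₀ a₁ u₀ w₀ w₁ u₁ := by
        gcongr with κ₀ _ a₀ _ u₀ w₀
        exact hBpt _ _ _ _ _ _ _
    _ = recP S B 1 a₁ u₁ w₁ := by
        rw [recP_succ, recP_zero]
        simp only [tsum_finsetSum]

/-- **Regrouping a pointwise bound into the block recursion** ([FvdH17] §6.2.1, the summation behind Lemma 6.1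
for general `N`; here `n` middle blocks, i.e. `N = n + 1` pivotal bonds `b_0, …, b_n` and `n + 2` levels).
Data: directions `e : K → G`; the start piece `S = P^{S,·}`, the closed middle block `B` of the recursion (6.49)
and a POINTWISE version `B_pt` of it with the internal vertices `t, z` explicit, `Σ_{t,z} B_pt ≤ B` (`hBpt`); the
last open block `Ā` and the end `P^E`.  Hypotheses: the diagram `Ξ` is bounded by a sum over all level data
`b_i = (u_i, v_i)`, `w_i`, `t_i`, `z_i` (`i ≤ n`) of a quantity `P` (`h1`), and `P` is bounded pointwise, after
splitting into the length classes `a_i` of the lines `(u_i, w_i)` and `c` of `(t_n, z_n)` and reading off the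
directions `κ_i` of the bonds, by the chain `𝟙{v = u + e_κ} · P^{S,a_0}(u_0,w_0) · ∏ B_pt · Ā · P^E` (`h2`).
Conclusion: the `x`-space bound in the form consumed by `tsum_le_vecMul_pow_dotProduct'` (one `x`):
`Ξ ≤ Σ_{u,w,t,z} Σ_{κ,a,c} P^{(n),a}(u,w) Ā^{κ,a,c}(u,w,t,z) P^{E,c}(t − x, z − x)`.
Proof: induction on `n`, summing the first level (`level0_le_recP_one`) and `P^{(n+1)} = (P^{(1)})^{(n)}`.
[cite: FitznerVanDerHofstad2017, §6.2.1 (6.48)–(6.51) and p. 67 "To prove the bounds for all `N` we use induction on `N`" (arXiv:1506.07977v2 pp. 65–67)] -/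
theorem le_recP_chain_of_pointwise (e : K → G) (B : K → ι → ι → G → G → G → G → ℝ≥0∞)
    (Bpt : K → ι → ι → G → G → G → G → G → G → ℝ≥0∞)
    (hBpt : ∀ κ a a' u w w' u', ∑' t, ∑' z, Bpt κ a a' u w t z w' u' ≤ B κ a a' u w w' u')
    (A : K → ι → ι → G → G → G → G → ℝ≥0∞) (PE : ι → G → G → ℝ≥0∞) (x : G) :
    ∀ (n : ℕ) (S : ι → G → G → ℝ≥0∞) (Ξ : ℝ≥0∞)
      (P : (Fin (n + 1) → G × G) → (Fin (n + 1) → G) → (Fin (n + 1) → G) → (Fin (n + 1) → G) → ℝ≥0∞),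
      Ξ ≤ ∑' b, ∑' w, ∑' t, ∑' z, P b w t z →
      (∀ b w t z, P b w t z ≤ ∑ κ : Fin (n + 1) → K, ∑ a : Fin (n + 1) → ι, ∑ c : ι,
          dirInd e κ b * (S (a 0) (b 0).1 (w 0) * chainTail Bpt A PE x n κ a c b w t z)) →
      Ξ ≤ ∑' u, ∑' w, ∑' t, ∑' z, ∑ κ, ∑ a, ∑ c,
        recP S B n a u w * A κ a c u w t z * PE c (t - x) (z - x)
  | 0, S, Ξ, P, h1, h2 => by
    refine h1.trans ?_
    rw [tsum_pi_one₄]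
    refine (ENNReal.tsum_le_tsum fun b₀ => ENNReal.tsum_le_tsum fun w₀ => ENNReal.tsum_le_tsum fun t₀ =>
      ENNReal.tsum_le_tsum fun z₀ => h2 _ _ _ _).trans (le_of_eq ?_)
    simp only [sum_pi_succ (n := 0), sum_pi_zero, dirInd_cons, dirInd_nil, mul_one, chainTail_zero,
      Fin.cons_zero, recP_zero]
    rw [ENNReal.tsum_prod']
    simp only [tsum_finsetSum]
    refine Finset.sum_congr rfl fun κ₀ _ => Finset.sum_congr rfl fun a₀ _ => Finset.sum_congr rfl fun c _ =>
      tsum_congr fun u₀ => ?_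
    rw [tsum_rot₄]
    simp only [tsum_ite_dir_mul, mul_assoc]
  | n + 1, S, Ξ, P, h1, h2 => by
    -- the level-`0`-summed data
    let P₁ : (Fin (n + 1) → G × G) → (Fin (n + 1) → G) → (Fin (n + 1) → G) → (Fin (n + 1) → G) → ℝ≥0∞ :=
      fun b' w' t' z' => ∑' b₀, ∑' w₀, ∑' t₀, ∑' z₀,
        P (Fin.cons b₀ b') (Fin.cons w₀ w') (Fin.cons t₀ t') (Fin.cons z₀ z')
    have h1₁ : Ξ ≤ ∑' b', ∑' w', ∑' t', ∑' z', P₁ b' w' t' z' := h1.trans_eq (tsum_pi_succ₄ P)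
    have hterm : ∀ i D s bp ct : ℝ≥0∞, i * D * (s * (bp * ct)) = D * (ct * (i * (s * bp))) :=
      fun _ _ _ _ _ => by ring
    have h2₁ : ∀ b' w' t' z', P₁ b' w' t' z' ≤ ∑ κ : Fin (n + 1) → K, ∑ a : Fin (n + 1) → ι, ∑ c : ι,
        dirInd e κ b' * (recP S B 1 (a 0) (b' 0).1 (w' 0) * chainTail Bpt A PE x n κ a c b' w' t' z') := by
      intro b' w' t' z'
      refine (ENNReal.tsum_le_tsum fun b₀ => ENNReal.tsum_le_tsum fun w₀ => ENNReal.tsum_le_tsum fun t₀ =>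
        ENNReal.tsum_le_tsum fun z₀ => h2 _ _ _ _).trans ?_
      calc _ = ∑ κ : Fin (n + 1) → K, ∑ a : Fin (n + 1) → ι, ∑ c : ι, ∑ κ₀ : K, ∑ a₀ : ι, dirInd e κ b' *
            (chainTail Bpt A PE x n κ a c b' w' t' z' * ∑' b₀ : G × G, ∑' w₀, ∑' t₀, ∑' z₀,
              (if b₀.2 = b₀.1 + e κ₀ then (1 : ℝ≥0∞) else 0) *
                (S a₀ b₀.1 w₀ * Bpt κ₀ a₀ (a 0) b₀.1 w₀ t₀ z₀ (w' 0) (b' 0).1)) := by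
            simp only [tsum_finsetSum, sum_pi_succ' (n := n + 1), dirInd_cons, chainTail_succ_cons,
              Fin.cons_zero, hterm, ENNReal.tsum_mul_left]
            exact Finset.sum_congr rfl fun κ _ =>
              Finset.sum_comm.trans (Finset.sum_congr rfl fun a _ => sum_rot₃' _)
        _ = ∑ κ : Fin (n + 1) → K, ∑ a : Fin (n + 1) → ι, ∑ c : ι, dirInd e κ b' *
            (chainTail Bpt A PE x n κ a c b' w' t' z' * ∑ κ₀ : K, ∑ a₀ : ι, ∑' b₀ : G × G, ∑' w₀, ∑' t₀, ∑' z₀,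
              (if b₀.2 = b₀.1 + e κ₀ then (1 : ℝ≥0∞) else 0) *
                (S a₀ b₀.1 w₀ * Bpt κ₀ a₀ (a 0) b₀.1 w₀ t₀ z₀ (w' 0) (b' 0).1)) := by
            simp only [Finset.mul_sum]
        _ ≤ ∑ κ : Fin (n + 1) → K, ∑ a : Fin (n + 1) → ι, ∑ c : ι, dirInd e κ b' *
            (chainTail Bpt A PE x n κ a c b' w' t' z' * recP S B 1 (a 0) (b' 0).1 (w' 0)) := by
            gcongr with κ _ a _ c _
            exact level0_le_recP_one e S B Bpt hBpt _ _ _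
        _ = _ := Finset.sum_congr rfl fun κ _ => Finset.sum_congr rfl fun a _ =>
            Finset.sum_congr rfl fun c _ => by ring
    rw [recP_succ_eq_recP_recP_one]
    exact le_recP_chain_of_pointwise e B Bpt hBpt A PE x n (recP S B 1) Ξ P₁ h1₁ h2₁

end Chain

end Literature.Probability.FitznerVanDerHofstad2017.BlockSummation

/-! ## The length classes of an `N`-level diagram and the assembly of the `x`-space bound from class estimates

[FvdH17] §6.1 (p. 58) splits the `N = 1` diagram according to the length classes `a, b ∈ {0,1,2}` of the lines
`(u, w)` and `(t, z)` ("Case `a = 0`: `w = u` … `a = 1`: `u` and `w` are neighbors … `a = 2` …"); for general `N`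
(§6.2.1, p. 67: "To prove the bounds for all `N` we use induction on `N`") every level carries such a class: `a_i`
for the line `(u_i, w_i)` read on level `i` (`i ≤ n`) and `c` for the last line `(t_n, z_n)` read on the last
level `n + 1` (at `n = 0` this is `NobleBoundsN1Classes.clsSet u w t z a c`).  `nobleXiT_le_recP_chain_of_cls`
is the bookkeeping interface for general `N = n + 1`: from a joint form
`Ξ^{(n+1)}(x) ≤ Σ_{b,w,t,z} (∏ J(b_i)) ℙ^{⊗(n+2)}(E(b,w,t,z))` and ONE pointwise estimate per class tuple `(a, c)`,
conclude the `x`-space bound `Ξ^{(n+1)}(x) ≤ Σ_{u,w,t,z} Σ_{κ,a,c} P^{(n),a}(u,w) Ā^{κ,a,c}(u,w,t,z) P^{E,c}(t−x,z−x)`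
of Lemma 6.1 / (6.4), i.e. the hypothesis `hΞ` of the chain theorems of `BlockSummation`.  The event family `E`
and all block families are parameters.
-/

namespace Literature.Probability.FitznerVanDerHofstad2017

open Literature.Barriers.CriticalPhenomena Literature.Probability.Percolation Literature.Probability.LatticeModels
open Literature.Probability.FitznerVanDerHofstad2017.NobleBlocks _root_.MeasureTheory
open Literature.Probability.FitznerVanDerHofstad2017.BlockSummation
open scoped ENNReal BigOperators

variable {d : ℕ}

open Classical in
/-- **The length class of the line `{a ↔ b}` on one configuration**: `0` = trivial line (`a = b`), `1` = `a ≠ b`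
and the bond `(a, b)` is open, `2` = `a ≠ b` and the bond `(a, b)` is not open (cf. `NobleBoundsN1Classes.lineCls`,
the same trichotomy as an event on two levels).
[cite: FitznerVanDerHofstad2017, §6.1 "Case a = 0 / a = 1 / a = 2" (arXiv:1506.07977v2 pp. 58–59)] -/
def lineClass (a b : Site d) (η : BondConfig (Site d)) : Fin 3 :=
  if a = b then 0 else if s(a, b) ∈ η then 1 else 2

/-- Class `0` is the trivial line. [cite: FitznerVanDerHofstad2017, §6.1 "Case a = 0" (arXiv:1506.07977v2 p. 58)] -/
theorem lineClass_eq_zero_iff (a b : Site d) (η : BondConfig (Site d)) : lineClass a b η = 0 ↔ a = b := by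
  unfold lineClass
  by_cases hab : a = b
  · simp [hab]
  · by_cases he : s(a, b) ∈ η <;> simp [hab, he]

/-- Class `1` is the open bond. [cite: FitznerVanDerHofstad2017, §6.1 "Case a = 1" (arXiv:1506.07977v2 p. 59)] -/
theorem lineClass_eq_one_iff (a b : Site d) (η : BondConfig (Site d)) :
    lineClass a b η = 1 ↔ a ≠ b ∧ s(a, b) ∈ η := by
  unfold lineClass
  by_cases hab : a = b
  · simp [hab]
  · by_cases he : s(a, b) ∈ η <;> simp [hab, he]

/-- Class `2` is a longer line. [cite: FitznerVanDerHofstad2017, §6.1 "Case a = 2" (arXiv:1506.07977v2 p. 59)] -/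
theorem lineClass_eq_two_iff (a b : Site d) (η : BondConfig (Site d)) :
    lineClass a b η = 2 ↔ a ≠ b ∧ s(a, b) ∉ η := by
  unfold lineClass
  by_cases hab : a = b
  · simp [hab]
  · by_cases he : s(a, b) ∈ η <;> simp [hab, he]

/-- The class of a line is a measurable function of the configuration. [folklore] -/
theorem measurable_lineClass (a b : Site d) : Measurable (lineClass a b) := by
  classical
  unfold lineClass
  by_cases hab : a = b
  · simp only [hab, if_true]
    exact measurable_const
  · simp only [hab, if_false]
    exact Measurable.ite (measurableSet_mem _) measurable_const measurable_const

/-- **The class tuple `(a, c)` of an `(n+2)`-level configuration**: class `a i` of the line `{u_i ↔ w_i}` read on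
level `i` (`i ≤ n`) and class `c` of the line `{t ↔ z}` read on the last level `n + 1`.
[cite: FitznerVanDerHofstad2017, §6.1 (6.4) and §6.2.1 p. 67 (arXiv:1506.07977v2 pp. 58, 67)] -/
def clsSetN {n : ℕ} (u w : Fin (n + 1) → Site d) (t z : Site d) (a : Fin (n + 1) → Fin 3) (c : Fin 3) :
    Set (Fin (n + 2) → BondConfig (Site d)) :=
  {ω | (∀ i, lineClass (u i) (w i) (ω i.castSucc) = a i) ∧ lineClass t z (ω (Fin.last (n + 1))) = c}

/-- Membership (definitional). [cite: FitznerVanDerHofstad2017, §6.1 (arXiv:1506.07977v2 p. 58)] -/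
theorem mem_clsSetN_iff {n : ℕ} (u w : Fin (n + 1) → Site d) (t z : Site d) (a : Fin (n + 1) → Fin 3) (c : Fin 3)
    (ω : Fin (n + 2) → BondConfig (Site d)) :
    ω ∈ clsSetN u w t z a c ↔ (∀ i, lineClass (u i) (w i) (ω i.castSucc) = a i) ∧
      lineClass t z (ω (Fin.last (n + 1))) = c := Iff.rfl

/-- The class sets are measurable. [folklore] -/
theorem measurableSet_clsSetN {n : ℕ} (u w : Fin (n + 1) → Site d) (t z : Site d) (a : Fin (n + 1) → Fin 3)
    (c : Fin 3) : MeasurableSet (clsSetN u w t z a c) := by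
  have h1 : ∀ i : Fin (n + 1), MeasurableSet {ω : Fin (n + 2) → BondConfig (Site d) |
      lineClass (u i) (w i) (ω i.castSucc) = a i} := fun i =>
    ((measurable_lineClass (u i) (w i)).comp (measurable_pi_apply (Fin.castSucc i)))
      (measurableSet_singleton (a i))
  have h2 : MeasurableSet {ω : Fin (n + 2) → BondConfig (Site d) | lineClass t z (ω (Fin.last (n + 1))) = c} :=
    ((measurable_lineClass t z).comp (measurable_pi_apply (Fin.last (n + 1)))) (measurableSet_singleton c)
  have : clsSetN u w t z a c = (⋂ i, {ω : Fin (n + 2) → BondConfig (Site d) |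
      lineClass (u i) (w i) (ω i.castSucc) = a i}) ∩ {ω | lineClass t z (ω (Fin.last (n + 1))) = c} := by
    ext ω
    simp only [clsSetN, Set.mem_setOf_eq, Set.mem_inter_iff, Set.mem_iInter]
  rw [this]
  exact (MeasurableSet.iInter h1).inter h2

/-- The class tuples cover. [cite: FitznerVanDerHofstad2017, §6.1 (arXiv:1506.07977v2 p. 58)] -/
theorem iUnion_clsSetN {n : ℕ} (u w : Fin (n + 1) → Site d) (t z : Site d) :
    ⋃ a, ⋃ c, clsSetN u w t z a c = Set.univ :=
  Set.eq_univ_of_forall fun ω => Set.mem_iUnion.2 ⟨fun i => lineClass (u i) (w i) (ω i.castSucc),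
    Set.mem_iUnion.2 ⟨lineClass t z (ω (Fin.last (n + 1))), fun _ => rfl, rfl⟩⟩

/-- **Splitting an event into the class tuples**: `μ(E) ≤ Σ_{a,c} μ(E ∩ class (a,c))`.
[cite: FitznerVanDerHofstad2017, §6.1 (6.4) (arXiv:1506.07977v2 p. 58)] -/
theorem measure_le_sum_inter_clsSetN {n : ℕ} (μ : Measure (Fin (n + 2) → BondConfig (Site d)))
    (E : Set (Fin (n + 2) → BondConfig (Site d))) (u w : Fin (n + 1) → Site d) (t z : Site d) :
    μ E ≤ ∑ a : Fin (n + 1) → Fin 3, ∑ c : Fin 3, μ (E ∩ clsSetN u w t z a c) := by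
  have hcov : E ⊆ ⋃ a, ⋃ c, E ∩ clsSetN u w t z a c := by
    intro ω hω
    have h := Set.mem_univ ω
    rw [← iUnion_clsSetN u w t z] at h
    obtain ⟨a, ha⟩ := Set.mem_iUnion.1 h
    obtain ⟨c, hc⟩ := Set.mem_iUnion.1 ha
    exact Set.mem_iUnion.2 ⟨a, Set.mem_iUnion.2 ⟨c, hω, hc⟩⟩
  calc μ E ≤ μ (⋃ a, ⋃ c, E ∩ clsSetN u w t z a c) := measure_mono hcov
    _ ≤ ∑' a, μ (⋃ c, E ∩ clsSetN u w t z a c) := measure_iUnion_le _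
    _ ≤ ∑' a, ∑' c, μ (E ∩ clsSetN u w t z a c) := ENNReal.tsum_le_tsum fun a => measure_iUnion_le _
    _ = ∑ a, ∑ c, μ (E ∩ clsSetN u w t z a c) := by simp only [tsum_fintype]

/-- **[FvdH17] Lemma 6.1 / (6.4) for general `N = n + 1`, assembly from class estimates.**  Let `E(b,w,t,z)` be
events on `n + 2` levels, indexed by the pivotal bonds `b_i = (u_i, v_i)`, attachment points `w_i` and sausage
end-points `t_i, z_i` (`i ≤ n`), with `Ξ^{(n+1)}_p(x) ≤ Σ_{b,w,t,z} (∏_i J(v_i − u_i)) ℙ_p^{⊗(n+2)}(E(b,w,t,z))`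
(a union bound on the exact nested form `NobleNestedXi.nobleXiT_succ_succ_eq_tsum`; the weight
`∏_i J(v_i − u_i)` is written out — it is `NobleNestedXi.bondJProd d p b` by `rfl`), and suppose the CLASS
ESTIMATES: for every class tuple `(a, c)`, `(∏ J) ℙ^{⊗(n+2)}(E ∩ class (a,c)) ≤ Σ_κ 𝟙{v = u + e_κ} P^{S,a_0}(u_0,w_0)
∏_{i<n} B_pt^{κ_i,a_i,a_{i+1}}(u_i,w_i,t_i,z_i,w_{i+1},u_{i+1}) Ā^{κ_n,a_n,c}(u_n,w_n,t_n,z_n) P^{E,c}(t_n−x,z_n−x)`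
with pointwise middle blocks summing to the closed block of the recursion, `Σ_{t,z} B_pt ≤ B`.  Then
`Ξ^{(n+1)}_p(x) ≤ Σ_{u,w,t,z} Σ_κ Σ_{a,c} P^{(n),a}(u,w) Ā^{κ,a,c}(u,w,t,z) P^{E,c}(t−x,z−x)` — the `x`-space bound
(6.51)/(6.4), hypothesis `hΞ` (at `x`) of `BlockSummation.tsum_le_vecMul_pow_dotProduct'`.
[cite: FitznerVanDerHofstad2017, §6.1 (6.4) (p. 58), Lemma 6.1 (6.51) (p. 66), §6.2.1 p. 67 (arXiv:1506.07977v2)] -/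
theorem nobleXiT_le_recP_chain_of_cls (p : unitInterval) (x : Site d) (n : ℕ)
    (S : Fin 3 → Site d → Site d → ℝ≥0∞)
    (B : (Fin d × Bool) → Fin 3 → Fin 3 → Site d → Site d → Site d → Site d → ℝ≥0∞)
    (Bpt : (Fin d × Bool) → Fin 3 → Fin 3 → Site d → Site d → Site d → Site d → Site d → Site d → ℝ≥0∞)
    (hBpt : ∀ κ a a' u w w' u', ∑' t, ∑' z, Bpt κ a a' u w t z w' u' ≤ B κ a a' u w w' u')
    (A : (Fin d × Bool) → Fin 3 → Fin 3 → Site d → Site d → Site d → Site d → ℝ≥0∞)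
    (PE : Fin 3 → Site d → Site d → ℝ≥0∞)
    (E : (Fin (n + 1) → Site d × Site d) → (Fin (n + 1) → Site d) → (Fin (n + 1) → Site d) →
      (Fin (n + 1) → Site d) → Set (Fin (n + 2) → BondConfig (Site d)))
    (h1 : nobleXiT d p (n + 1) x ≤ ∑' b : Fin (n + 1) → Site d × Site d, ∑' w : Fin (n + 1) → Site d,
      ∑' t : Fin (n + 1) → Site d, ∑' z : Fin (n + 1) → Site d,
      (∏ i, ENNReal.ofReal (bondJ d p ((b i).2 - (b i).1))) * piPerc d p (n + 2) (E b w t z))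
    (h2 : ∀ (a : Fin (n + 1) → Fin 3) (c : Fin 3) (b : Fin (n + 1) → Site d × Site d) (w t z : Fin (n + 1) → Site d),
      (∏ i, ENNReal.ofReal (bondJ d p ((b i).2 - (b i).1))) * piPerc d p (n + 2)
          (E b w t z ∩ clsSetN (fun i => (b i).1) w (t (Fin.last n)) (z (Fin.last n)) a c) ≤
        ∑ κ : Fin (n + 1) → Fin d × Bool, dirInd stepVec κ b *
          (S (a 0) (b 0).1 (w 0) * chainTail Bpt A PE x n κ a c b w t z)) :
    nobleXiT d p (n + 1) x ≤ ∑' u, ∑' w, ∑' t, ∑' z, ∑ κ : Fin d × Bool, ∑ a : Fin 3, ∑ c : Fin 3,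
      recP S B n a u w * A κ a c u w t z * PE c (t - x) (z - x) := by
  refine le_recP_chain_of_pointwise stepVec B Bpt hBpt A PE x n S _
    (fun b w t z => (∏ i, ENNReal.ofReal (bondJ d p ((b i).2 - (b i).1))) * piPerc d p (n + 2) (E b w t z)) h1 ?_
  intro b w t z
  calc (∏ i, ENNReal.ofReal (bondJ d p ((b i).2 - (b i).1))) * piPerc d p (n + 2) (E b w t z)
      ≤ (∏ i, ENNReal.ofReal (bondJ d p ((b i).2 - (b i).1))) * ∑ a, ∑ c, piPerc d p (n + 2)
          (E b w t z ∩ clsSetN (fun i => (b i).1) w (t (Fin.last n)) (z (Fin.last n)) a c) :=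
        mul_le_mul' le_rfl (measure_le_sum_inter_clsSetN _ _ _ w _ _)
    _ = ∑ a, ∑ c, (∏ i, ENNReal.ofReal (bondJ d p ((b i).2 - (b i).1))) * piPerc d p (n + 2)
          (E b w t z ∩ clsSetN (fun i => (b i).1) w (t (Fin.last n)) (z (Fin.last n)) a c) := by
        rw [Finset.mul_sum]; exact Finset.sum_congr rfl fun a _ => Finset.mul_sum _ _ _
    _ ≤ ∑ a, ∑ c, ∑ κ : Fin (n + 1) → Fin d × Bool, dirInd stepVec κ b *
          (S (a 0) (b 0).1 (w 0) * chainTail Bpt A PE x n κ a c b w t z) :=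
        Finset.sum_le_sum fun a _ => Finset.sum_le_sum fun c _ => h2 a c b w t z
    _ = _ := sum_rot₃' _

end Literature.Probability.FitznerVanDerHofstad2017

end
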